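import Mathlib
import HarnessLib
import Literature.MathematicalPhysics.QuantumFieldTheory.Balaban1983to89.B10
import Literature.MathematicalPhysics.QuantumFieldTheory.Balaban1983to89.B12TreeDecay
import Literature.MathematicalPhysics.QuantumFieldTheory.Balaban1983to89.B10Eq25Rate
import Literature.MathematicalPhysics.QuantumFieldTheory.Balaban1983to89.B10Eq35Norm

/-!
# `Balaban1983to89.B10Eq65PolymerSum` — [Balaban1985UV3] p. 273, the first clause of **(65)**: *"From (25), which
# holds for arbitrary j, we get easily |E^{(j)}| ≤ O(1)|T₁^{(j)}|"* — the polymer piece `|Σ_X 𝒫′_{j+1}(g_j, X, 1)| ≤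
# O(1)·#{big blocks}` PROVED from the typed (25) carrier `B10.Bound25Printed`, plus the two arithmetic sentences of
# p. 262 around (24) (*"the exponential factor in (23) yields the factor exp(−R), which is smaller than arbitrary
# power of ε"*)

T. Bałaban, *Ultraviolet stability of three-dimensional lattice pure gauge field theories*, Commun. Math. Phys. **102**,
255–275 (1985) [Balaban1985UV3] (cell paper B10; lit key `paper:balaban1985-cmp102-uv-stability-3d`, journal page =
PDF page + 254; pages re-read for this file on the renders
`run/shared/lean/pub/pub-balaban/b2b-balaban-ref1/pages/1985-cmp102-uv-stability-3d/…-p008-x2.png` (p. 262) and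
`…-p019-x2.png` (p. 273), 2026-08-21).

HONEST FRAMING (mega-formalization `lit-balaban`, verbatim): statement-level skeleton of published theorems with
citation tags; proofs where landed; nothing here is a claim about the Yang–Mills mass gap.

WHY THIS FILE EXISTS.  Unit `lit-balaban-r07` (reader/typer of B10), gen 5; SKELETON rows B10.Eq65 ← B10.Eq25 (and the
remainder sentence of B10.Eq24).  In the tree the per-step counterterm bound behind (64)–(65),
`B10.Estep62_abs_le` / `B10Assembly.LeafSystem.estep_abs_le`, takes the vacuum polymer sum as a HYPOTHESIS
(`hP : |Pvac| ≤ a·sites`, field `B10Assembly.LeafSystem.PprT_le` — docstring: *"(p. 273 from (25))"*), while the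
printed input (25) p. 262 is typed as `B10.Bound25Printed` (module `B10`) and PRODUCED from (23) by the b2b module
`B10Eq25Rate` (`bound25_of_bound23`, `bound25_of_bound118`) — but CONSUMED by nothing.  This module is the missing
edge (25) → (65): over the cube carriers of `B12TreeDecay` (localization domains = connected families of big blocks,
`CubeSystem`; wall-degree ≤ Δ, `DegreeLE`; the quoted volume-versus-tree-length leaf `VolumeLeaf c₀` =
[Dimock2013BalabanII] Lemma E.1, never asserted) the anchored tree-decay summability (1.26) of [Balaban1988RG2Cluster]
in its "touching" form `B12TreeDecay.ineq126_touches` (Dimock I Cor. 26), taken with `Y` = ALL blocks, gives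

* `sum_exp_tree_le_card` — `Σ_{X ∈ 𝐃} exp(−κ𝓛(X)) ≤ K₀(c₀,Δ)·#blocks` for `κ ≥ κ₀(c₀,Δ)`;
* `sum_abs_act_le_of_bound25` / `abs_sum_act_le_of_bound25` — **(25) ⇒ `|Σ_X 𝒫′(X, U)| ≤ Σ_X |𝒫′(X, U)| ≤
  C·g·K₀(c₀,Δ)·#blocks`** for every configuration `U`, every rate `κ ≥ κ₀(c₀,Δ)` (the printed *"κ can be arbitrarily
  large if M₁ is sufficiently large"* is exactly what makes the threshold available) — the O(1) of p. 273 is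
  `C·g·K₀(c₀,Δ)`, depending on the (25) constants and on (c₀, Δ) = the dimension only, NOT on j, the lattice or U;
* `abs_sum_act_le_sites`, `pprT_le_of_bound25` — the same in units of unit-lattice sites (`#blocks ≤ |T₁^{(j)}|`: a big
  block holds M₁³ ≥ 1 sites), i.e. the hypothesis shape `|PprT| ≤ aP·|T₁^{(j)}|` of `B10Assembly.LeafSystem.PprT_le`
  with `aP = C·g·K₀(c₀,Δ)`;
* `estep62_abs_le_of_bound25` — `B10.Estep62_abs_le` ((62) ⇒ `|E^{(j)}| ≤ (3|log σ₀| + z + aP + 3d(𝔤)|log g_j|)·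
  |T₁^{(j)}|`) with its hypothesis `hP` DISCHARGED from (25);
* `norm_total_le_of_bound25` — the same edge for the b2b complex carrier `B10Eq25Rate.activitiesOf D E R` (activity =
  ‖E(X, U)‖ on the real configurations `R`): (25) ⇒ `‖Σ_X E(X, U)‖ ≤ C·g·K₀·#blocks`, so that
  `B10Eq25Rate.bound25_of_bound23` (B9 (3.108) ⇒ (23) ⇒ (25)) now feeds (65) BY NAME;
* p. 262 [8] around (24), verbatim: *"especially if X is not contained in a cube of the size RM₁, then the
  exponential factor in (23) yields the factor exp(−R), which is smaller than arbitrary power of ε"* — as arithmetic: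
  `expFactor23_le_exp_neg_R` (tree length ≥ RM₁ in lattice units and ½δ₀M₁ ≥ 1 ⇒ `e^{−½δ₀d} ≤ e^{−R}`);
  `exp_neg_R_le_pow` (R = R₁r(g) = R₁(1 + log g⁻¹)^{r₀} of p. 257: for `r₀ ≥ 1`, `R₁ ≥ N`, `0 < g ≤ 1`:
  `e^{−R} ≤ g^N`); `exp_neg_R_le_pow_of_one_lt` (the asymptotic reading with `R₁ > 0` FIXED: for `r₀ > 1` and every
  `N`, `e^{−R₁r(g)} ≤ g^N` for all `0 < g ≤ e^{−u₀}`, `u₀ = (N/R₁)^{1/(r₀−1)}` — print leaves `r₀` free (cell GAPS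
  G-B10-02); with `r₀ = 1` only the fixed power `g^{R₁}` is available); `exp_neg_R_gRun_le_eps_pow` (at `g₀ = gε^{1/2}`
  (p. 256): `e^{−R₁r(g₀)} ≤ ε^N` for `R₁ ≥ 2N`, `0 < g, ε ≤ 1`).

v1.1 (same unit, append-only §6) — the OTHER silent input of p. 273's *"we get easily"*: the whole-lattice
Gaussian normalisation `log Z^{(k)}(T₁^{(k)}, 1)` of (62) is EXTENSIVE, `|log Z^{(k)}(T₁^{(k)}, 1)| ≤ z|T₁^{(k)}|`
(hypothesis `hZ` of `B10.Estep62_abs_le`, field `B10Assembly.LeafSystem.logZT_le`: *"(p. 273, implicit in «we get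
easily»)"*).  Print only NAMES Z^{(0)} ((22) p. 261: *"dμ is a Gaussian measure with a covariance having an exponential
decay property (and many other properties, see Sect. E in [5])"*; cell GAPS G-B10-03); under the located model of
`B10Eq35Norm` (log Z = a constraint-elimination constant J + the log of a Gaussian integral of a symmetric precision
form with spectrum in [c, a], 0 < c — positivity = [5] Thm 3.11) the one-sided volume law gives it:
* `abs_log_gaussian_le_of_form_bounds` — `|log ∫ e^{−½⟨v,Qv⟩}dv| ≤ |n|·½(log 2π + max(|log c|, |log a|))` for
  `c·1 ⪯ Q ⪯ a·1` (via `Beta.GaussianIntegral.log_integral_exp_neg_half_quadForm` and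
  `B10Eq35Norm.abs_log_det_le_of_form_bounds`, by name);
* `logZT_le_of_gaussian` — hence `|log Z| ≤ (c_T·½(log 2π + max(|log c|, |log a|)) + c_J)·|T₁^{(k)}|` when the number
  of integration variables is `≤ c_T|T₁^{(k)}|` and `|J| ≤ c_J|T₁^{(k)}|` (located counts, hypotheses);
* `estep62_abs_le_discharged` — `B10.Estep62_abs_le` with BOTH `hP` (from (25), §3) and `hZ` (from the Gaussian model)
  discharged: `|E^{(j)}| ≤ (3|log σ₀| + z + aP + 3d(𝔤)|log g_j|)|T₁^{(j)}|` with `z`, `aP` explicit.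

v1.3 — `sum_abs_act_le_of_bound25_treeLength`, `abs_sum_act_le_sites_treeLength` (§7): the same edge WITHOUT the
quoted volume leaf — the elementary tree-length bound `𝓛(X) ≥ ℓ₀(#blocks(X) − 1)` (p. 262: centres of neighbouring
blocks at distance 1; ℓ₀ = 1 for trees on the centres, ½ with Steiner points) makes the auxiliary size
`ℓ₀(#blocks − 1)` satisfy the leaf with `c₀ = ℓ₀⁻¹` exactly; (25) transfers to it; hence
`Σ_X|𝒫′| ≤ C·g·K₀(ℓ₀⁻¹,Δ)·#blocks` from the lattice-animal count alone.

v1.2 — records: `exp_neg_R_le_pow` (reading 1) was already certified in stronger form by `B10Assembly.largeLoc_le_rpow`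
(b2b §4c, cell GAPS C-r2.31; found after filing v1) — docstring cross-reference added, statement kept; NEW
`exp_neg_R_gRun_le_eps_pow_of_one_lt`: the `r₀ > 1`, `R₁`-FIXED reading in ε-form (`ε ≤ e^{−2u₀}` ⇒ `e^{−R₁r(g₀)} ≤
εᴺ`), i.e. what `r₀ > 1` buys relative to cell SMALLNESS S-B10.9 (no largeness of R₁ needed).

WHAT IS NOT HERE.  The geometry of the torus blocks (that the big blocks of `T₁^{(j)}` with wall adjacency have
≤ 2d = 6 neighbours and that the GK tree length 𝓛 of [19] obeys the volume leaf are inputs BY NAME, exactly as in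
`B12TreeDecay` — cell DIVERGENCE F5); the restriction of (24) to *"localizations X which have diameter smaller than
RM₁"* and the count behind *"we get O(ε^κ)|T₁|"*; the other three terms of (62) (`log σ₀|T*|`, `d(𝔤) log g_k|T*|`,
`log Z^{(k)}(T, 1)` — hypotheses of `B10.Estep62_abs_le` as before); (25) itself (typed leaf / b2b edge).  Theorems
only, no new definitions (the `B10.PolymerActivities` structure literal `⟨𝐃, Cfg, 𝓛, 𝒫′⟩` is used in the statements); imports `B10`, `B12TreeDecay`, `B10Eq25Rate` (+ `B10Eq35Norm`, v1.1); nothing modified.  Value = one kernel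
edge of the B10 skeleton (E25 → E65) + located arithmetic, NOT summit progress.

## References
* [Balaban1985UV3] T. Bałaban, Commun. Math. Phys. 102 (1985) 255–275 — (23)–(25) p. 262, (62) p. 271, (64)–(65)
  p. 273, (7) p. 257 (R = R₁r(g₀)).
* [Balaban1988RG2Cluster] T. Bałaban, Commun. Math. Phys. 116 (1988) 1–22 — (1.26) p. 8 (tree-decay summability;
  kernel-checked modulo the volume leaf in `B12TreeDecay`).
* [Dimock2013] J. Dimock, Rev. Math. Phys. 25 (2013) 1330010 — App. A Lemma 25 / Cor. 26 (the printed proof followed by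
  `B12TreeDecay`).
* [Dimock2013BalabanII] J. Dimock, J. Math. Phys. 54 (2013) 092301 — App. E Lemma E.1 (the volume leaf).
-/

noncomputable section

open Finset
open Literature.MathematicalPhysics.QuantumFieldTheory.Balaban1983to89
open Literature.MathematicalPhysics.QuantumFieldTheory.Balaban1983to89.B12TreeDecay
  (CubeSystem kappa₀ K₀ K₀_pos ineq126_touches)

namespace Literature.MathematicalPhysics.QuantumFieldTheory.Balaban1983to89.B10Eq65PolymerSum

/-! ## §1. The localization domains of (24)–(25) as a `B10.PolymerActivities` over the shared carrier -/

section Bridge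

/-- The polymer activities `Σ_X 𝒫′(g, X, U)` of (24)–(25) p. 262 [8] over the shared carrier of localization domains
(`LocDomainSys`: the finite type `𝐃` of domains X = *"connected unions of big blocks"* with the tree length
`dj X` = 𝓛(X) of [19]) are the `B10.PolymerActivities` structure `⟨𝐃, Cfg, 𝓛, 𝒫′⟩` (polymers = the domains,
𝓛 = `dj`, any configuration type, a real activity; `B10Eq25Rate.activitiesOf` is the instance with activity = the norm
of a complex one, `activitiesOf_eq_mk`).  (25) on it, unfolded: `|𝒫′(X, U)| ≤ C·g·e^{−κ𝓛(X)}` for all X, U.  No new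
definition is introduced (the structure literal is used in the statements below). [cite: Balaban1985UV3, (24)–(25) p.262] -/
theorem bound25_mk_iff (S : LocDomainSys) (Cfg : Type) (act : S.Dom → Cfg → ℝ) (g κ C : ℝ) :
    B10.Bound25Printed ⟨S.Dom, Cfg, S.dj, act⟩ g κ C ↔
      ∀ (X : S.Dom) (U : Cfg), |act X U| ≤ C * g * Real.exp (-(κ * S.dj X)) :=
  Iff.rfl

end Bridge

/-! ## §2. The tree-decay sum over ALL domains: `Σ_X exp(−κ𝓛(X)) ≤ K₀·#blocks` -/

section AllDomains

variable {S : LocDomainSys} (G : CubeSystem S)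

/-- Every domain meets the family of all blocks (a domain is a NONEMPTY family of blocks), so "the domains touching
`Y` = all blocks" are all domains (private plumbing). [folklore] -/
private theorem filter_meets_univ :
    (Finset.univ.filter fun X : S.Dom => (G.cubes X ∩ (Finset.univ : Finset G.Cube)).Nonempty) = Finset.univ :=
  Finset.filter_true_of_mem fun X _ => by
    rw [Finset.inter_univ]
    exact (G.connected X).1

/-- **(1.26) [Balaban1988RG2Cluster] summed over the anchors** (Dimock I Cor. 26 with `Y` = all blocks): if every block
has at most `Δ` wall-neighbours and the volume leaf `#blocks(X) ≤ c₀(1 + 𝓛(X))` holds, then for every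
`κ ≥ κ₀(c₀,Δ) = c₀ log(2(Δ+1)²)`: `Σ_{X ∈ 𝐃} exp(−κ𝓛(X)) ≤ K₀(c₀,Δ)·#blocks`.  By name from
`B12TreeDecay.ineq126_touches`. [cite: Balaban1988RG2Cluster, (1.26) p.8] -/
theorem sum_exp_tree_le_card {Δ : ℕ} (hΔ : G.DegreeLE Δ) {c₀ : ℝ} (hV : G.VolumeLeaf c₀) {κ : ℝ}
    (hκ : kappa₀ c₀ Δ ≤ κ) :
    ∑ X : S.Dom, Real.exp (-κ * S.dj X) ≤ K₀ c₀ Δ * Fintype.card G.Cube := by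
  have h := ineq126_touches G hΔ hV hκ (Finset.univ : Finset G.Cube)
  rw [filter_meets_univ G, Finset.card_univ] at h
  exact h

end AllDomains

/-! ## §3. (25) ⇒ the first clause of (65): `|Σ_X 𝒫′_{j+1}(g_j, X, U)| ≤ O(1)·#blocks ≤ O(1)|T₁^{(j)}|` -/

section Eq65

variable {S : LocDomainSys} (G : CubeSystem S) {Δ : ℕ} {c₀ κ g C : ℝ} {Cfg : Type}

/-- **(25) ⇒ Σ_X |𝒫′(X, U)| ≤ C·g·K₀(c₀,Δ)·#blocks** (p. 273 [19]: *"From (25), which holds for arbitrary j, we get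
easily |E^{(j)}| ≤ O(1)|T₁^{(j)}|"* — the polymer-sum part, for every configuration U, in particular U = 1): termwise
(25), then `sum_exp_tree_le_card`.  Hypotheses: wall-degree ≤ Δ, the volume leaf, `κ ≥ κ₀(c₀,Δ)` (available because
*"κ can be arbitrarily large if M₁ is sufficiently large"*, (25)), and `0 ≤ C·g` (the printed `O(g₀)`). [cite: Balaban1985UV3, (65) p.273] -/
theorem sum_abs_act_le_of_bound25 (hΔ : G.DegreeLE Δ) (hV : G.VolumeLeaf c₀) (hκ : kappa₀ c₀ Δ ≤ κ)
    (act : S.Dom → Cfg → ℝ) (hCg : 0 ≤ C * g) (h25 : B10.Bound25Printed ⟨S.Dom, Cfg, S.dj, act⟩ g κ C) (U : Cfg) :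
    ∑ X : S.Dom, |act X U| ≤ C * g * K₀ c₀ Δ * Fintype.card G.Cube := by
  calc ∑ X : S.Dom, |act X U| ≤ ∑ X : S.Dom, C * g * Real.exp (-κ * S.dj X) :=
        Finset.sum_le_sum fun X _ => by rw [neg_mul]; exact h25 X U
    _ = C * g * ∑ X : S.Dom, Real.exp (-κ * S.dj X) := by rw [Finset.mul_sum]
    _ ≤ C * g * (K₀ c₀ Δ * Fintype.card G.Cube) :=
        mul_le_mul_of_nonneg_left (sum_exp_tree_le_card G hΔ hV hκ) hCg
    _ = C * g * K₀ c₀ Δ * Fintype.card G.Cube := by ring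

/-- **(25) ⇒ |Σ_X 𝒫′(X, U)| ≤ C·g·K₀(c₀,Δ)·#blocks** — the first clause of (65) p. 273 [19] for the vacuum polymer sum
(U = 1 in print; any U here), the O(1) being `C·g·K₀(c₀,Δ)`: independent of j, of the lattice and of U. [cite: Balaban1985UV3, (65) p.273] -/
theorem abs_sum_act_le_of_bound25 (hΔ : G.DegreeLE Δ) (hV : G.VolumeLeaf c₀) (hκ : kappa₀ c₀ Δ ≤ κ)
    (act : S.Dom → Cfg → ℝ) (hCg : 0 ≤ C * g) (h25 : B10.Bound25Printed ⟨S.Dom, Cfg, S.dj, act⟩ g κ C) (U : Cfg) :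
    |∑ X : S.Dom, act X U| ≤ C * g * K₀ c₀ Δ * Fintype.card G.Cube :=
  (Finset.abs_sum_le_sum_abs _ _).trans (sum_abs_act_le_of_bound25 G hΔ hV hκ act hCg h25 U)

/-- The same in units of unit-lattice sites, as printed (`O(1)|T₁^{(j)}|`): the big blocks of `T₁^{(j)}` are at most as
many as its sites (`#blocks·M₁³ = |T₁^{(j)}|`, M₁ ≥ 1), supplied as `#blocks ≤ sites`; then
`|Σ_X 𝒫′(X, U)| ≤ (C·g·K₀(c₀,Δ))·sites`. [cite: Balaban1985UV3, (65) p.273] -/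
theorem abs_sum_act_le_sites (hΔ : G.DegreeLE Δ) (hV : G.VolumeLeaf c₀) (hκ : kappa₀ c₀ Δ ≤ κ)
    (act : S.Dom → Cfg → ℝ) (hCg : 0 ≤ C * g) (h25 : B10.Bound25Printed ⟨S.Dom, Cfg, S.dj, act⟩ g κ C) (U : Cfg)
    {sites : ℝ} (hcs : (Fintype.card G.Cube : ℝ) ≤ sites) :
    |∑ X : S.Dom, act X U| ≤ (C * g * K₀ c₀ Δ) * sites :=
  (abs_sum_act_le_of_bound25 G hΔ hV hκ act hCg h25 U).trans
    (mul_le_mul_of_nonneg_left hcs (mul_nonneg hCg (K₀_pos c₀ Δ).le))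

/-- The hypothesis SHAPE of `B10Assembly.LeafSystem.PprT_le` (*"|Σ_X 𝒫′_{k+1}(g_k, X, 1)| ≤ aP|T₁^{(k)}| (p. 273 from
(25))"*) for a named piece `PprT` that IS the polymer sum of a (25)-bounded family over the cube carrier: `|PprT| ≤
aP·sites` with `aP = C·g·K₀(c₀,Δ)`. [cite: Balaban1985UV3, (65) p.273] -/
theorem pprT_le_of_bound25 (hΔ : G.DegreeLE Δ) (hV : G.VolumeLeaf c₀) (hκ : kappa₀ c₀ Δ ≤ κ)
    (act : S.Dom → Cfg → ℝ) (hCg : 0 ≤ C * g) (h25 : B10.Bound25Printed ⟨S.Dom, Cfg, S.dj, act⟩ g κ C) (U : Cfg)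
    {sites PprT : ℝ} (hcs : (Fintype.card G.Cube : ℝ) ≤ sites) (hP : PprT = ∑ X : S.Dom, act X U) :
    |PprT| ≤ (C * g * K₀ c₀ Δ) * sites := by
  rw [hP]
  exact abs_sum_act_le_sites G hΔ hV hκ act hCg h25 U hcs

/-- **(62) ⇒ the per-step bound of (65) with the polymer hypothesis DISCHARGED from (25)**: `B10.Estep62_abs_le`
(`|log σ₀·|T*| + d(𝔤) log g·|T*| + log Z^{(k)}(T, 1) + Σ_X 𝒫′| ≤ (3|log σ₀| + z + aP + 3 d(𝔤)|log g|)·|T₁^{(k)}|`,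
p. 271 (62) + p. 273 (65)) with `aP = C·g·K₀(c₀,Δ)` supplied by `abs_sum_act_le_sites`; the remaining inputs are the
other three terms of (62) (`|T*| ≤ 3|T|`, `|log Z| ≤ z|T|`), hypotheses as before. [cite: Balaban1985UV3, (62) p.271 + (65) p.273] -/
theorem estep62_abs_le_of_bound25 (hΔ : G.DegreeLE Δ) (hV : G.VolumeLeaf c₀) (hκ : kappa₀ c₀ Δ ≤ κ)
    (act : S.Dom → Cfg → ℝ) (hCg : 0 ≤ C * g) (h25 : B10.Bound25Printed ⟨S.Dom, Cfg, S.dj, act⟩ g κ C) (U : Cfg)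
    (logσ₀ dg logg logZ bonds sites z : ℝ) (hdg : 0 ≤ dg) (hb0 : 0 ≤ bonds) (hb : bonds ≤ 3 * sites)
    (hZ : |logZ| ≤ z * sites) (hcs : (Fintype.card G.Cube : ℝ) ≤ sites) :
    |logσ₀ * bonds + dg * logg * bonds + logZ + ∑ X : S.Dom, act X U|
      ≤ (3 * |logσ₀| + z + C * g * K₀ c₀ Δ + 3 * dg * |logg|) * sites :=
  B10.Estep62_abs_le logσ₀ dg logg logZ (∑ X : S.Dom, act X U) bonds sites (C * g * K₀ c₀ Δ) z hdg hb0 hb hZ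
    (abs_sum_act_le_sites G hΔ hV hκ act hCg h25 U hcs)

/-- The quantifier shape of the printed "O(1)" (p. 273) and of *"κ can be arbitrarily large"* ((25) p. 262): under
wall-degree ≤ Δ and the volume leaf there are a threshold `κ₁` and a constant `O1 > 0`, depending on (c₀, Δ) only,
such that EVERY (25)-bounded family at any rate `κ ≥ κ₁` with constant `C·g ≥ 0` has `|Σ_X 𝒫′(X, U)| ≤
O1·(C·g)·#blocks` for all U. [cite: Balaban1985UV3, (65) p.273] -/
theorem abs_sum_act_le_eventually (hΔ : G.DegreeLE Δ) (hV : G.VolumeLeaf c₀) :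
    ∃ κ₁ O1 : ℝ, 0 < O1 ∧ ∀ (κ' g' C' : ℝ) (Cfg' : Type) (act : S.Dom → Cfg' → ℝ), κ₁ ≤ κ' → 0 ≤ C' * g' →
      B10.Bound25Printed ⟨S.Dom, Cfg', S.dj, act⟩ g' κ' C' →
        ∀ U, |∑ X : S.Dom, act X U| ≤ O1 * (C' * g') * Fintype.card G.Cube :=
  ⟨kappa₀ c₀ Δ, K₀ c₀ Δ, K₀_pos c₀ Δ, fun _ _ _ _ act hκ hCg h25 U =>
    (abs_sum_act_le_of_bound25 G hΔ hV hκ act hCg h25 U).trans_eq (by ring)⟩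

end Eq65

/-! ## §4. The edge for the b2b complex carrier `B10Eq25Rate.activitiesOf` ((23) ⇒ (25) ⇒ (65) by name) -/

section Complex

variable {D : LocDomainSys} (G : CubeSystem D) {Δ : ℕ} {c₀ κ g C : ℝ} {Φ : Type}

/-- The b2b carrier `B10Eq25Rate.activitiesOf D E R` IS the structure `⟨𝐃, R, 𝓛, ‖E‖⟩` of §1 (definitionally). [cite: Balaban1985UV3, (24)–(25) p.262] -/
theorem activitiesOf_eq_mk (E : D.Dom → Φ → ℂ) (R : Set Φ) :
    B10Eq25Rate.activitiesOf D E R = ⟨D.Dom, R, D.dj, fun X U => ‖E X (U : Φ)‖⟩ := rfl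

/-- **(25) ⇒ (65) on the induced complex activities**: for a localized family `E : 𝐃 → Φ → ℂ` and real configurations
`R ⊆ Φ` with `B10.Bound25Printed (B10Eq25Rate.activitiesOf D E R) g κ C` (the OUTPUT of
`B10Eq25Rate.bound25_of_bound23` / `bound25_of_bound118`), wall-degree ≤ Δ, the volume leaf and `κ ≥ κ₀(c₀,Δ)`:
`‖Σ_X E(X, U)‖ ≤ Σ_X ‖E(X, U)‖ ≤ C·g·K₀(c₀,Δ)·#blocks` for every `U ∈ R`. [cite: Balaban1985UV3, (65) p.273] -/
theorem norm_total_le_of_bound25 (hΔ : G.DegreeLE Δ) (hV : G.VolumeLeaf c₀) (hκ : kappa₀ c₀ Δ ≤ κ)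
    (E : D.Dom → Φ → ℂ) (R : Set Φ) (hCg : 0 ≤ C * g)
    (h25 : B10.Bound25Printed (B10Eq25Rate.activitiesOf D E R) g κ C) (U : R) :
    ‖∑ X : D.Dom, E X (U : Φ)‖ ≤ C * g * K₀ c₀ Δ * Fintype.card G.Cube := by
  have h25' : B10.Bound25Printed ⟨D.Dom, R, D.dj, fun X U => ‖E X (U : Φ)‖⟩ g κ C := fun X U => h25 X U
  have h := sum_abs_act_le_of_bound25 G hΔ hV hκ (fun X (U : R) => ‖E X (U : Φ)‖) hCg h25' U
  simp only [abs_norm] at h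
  exact (norm_sum_le _ _).trans h

end Complex

/-! ## §5. p. 262 around (24): *"the exponential factor in (23) yields the factor exp(−R), which is smaller than
arbitrary power of ε"* -/

section Remainder24

/-- p. 262 [8], verbatim: *"especially if X is not contained in a cube of the size RM₁, then the exponential factor in
(23) yields the factor exp(−R)"* — as arithmetic: if the tree length of (23) is at least `R·M₁` (in lattice units; X
not inside a cube of size RM₁) and `½δ₀M₁ ≥ 1` (M₁ large), then `exp(−½δ₀d) ≤ exp(−R)` (for R ≥ 0, δ₀ ≥ 0).  The
geometric premise `d ≥ RM₁` is the hypothesis `hd`. [cite: Balaban1985UV3, (23)–(24) p.262] -/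
theorem expFactor23_le_exp_neg_R {δ₀ M₁ R d : ℝ} (hδ₀ : 0 ≤ δ₀) (hR : 0 ≤ R) (hM : 1 ≤ δ₀ * M₁ / 2)
    (hd : R * M₁ ≤ d) : Real.exp (-(δ₀ / 2 * d)) ≤ Real.exp (-R) := by
  apply Real.exp_le_exp.2
  have h1 : δ₀ / 2 * (R * M₁) ≤ δ₀ / 2 * d := mul_le_mul_of_nonneg_left hd (by linarith)
  have h2 : R * 1 ≤ R * (δ₀ * M₁ / 2) := mul_le_mul_of_nonneg_left hM hR
  nlinarith

/-- `gᴺ = exp(−N log g⁻¹)` for `g > 0` (the change of variables `u = log g⁻¹` of p. 257/p. 258, cf.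
`B10.smallFactor_le_pow`; private plumbing). [folklore] -/
private theorem pow_eq_exp_neg_log {g : ℝ} (hg : 0 < g) (N : ℕ) :
    g ^ N = Real.exp (-((N : ℝ) * Real.log g⁻¹)) := by
  rw [Real.log_inv, show -((N : ℝ) * -Real.log g) = (N : ℝ) * Real.log g by ring, Real.exp_nat_mul,
    Real.exp_log hg]

/-- `r(g) = (1 + log g⁻¹)^{r₀} ≥ log g⁻¹` for `r₀ ≥ 1`, `0 < g ≤ 1`. [cite: Balaban1985UV3, (7) p.257] -/
theorem log_inv_le_rFun {r₀ g : ℝ} (hr : 1 ≤ r₀) (hg : 0 < g) (hg1 : g ≤ 1) :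
    Real.log g⁻¹ ≤ B10.rFun r₀ g := by
  have hu : 0 ≤ Real.log g⁻¹ := B10.log_inv_nonneg_of_le_one hg hg1
  have h1 : (1 + Real.log g⁻¹) ^ (1 : ℝ) ≤ (1 + Real.log g⁻¹) ^ r₀ :=
    Real.rpow_le_rpow_of_exponent_le (by linarith) hr
  rw [Real.rpow_one] at h1
  unfold B10.rFun
  linarith

/-- p. 262 [8], verbatim: *"the factor exp(−R), which is smaller than arbitrary power of ε"* — first reading, with the
constant: `R = R₁r(g) = R₁(1 + log g⁻¹)^{r₀}` ((7) p. 257); for `r₀ ≥ 1`, `R₁ ≥ N` and `0 < g ≤ 1`: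
`exp(−R₁r(g)) ≤ gᴺ`.  (At `g = g₀ = gε^{1/2}` a power of g₀ is a power of ε: `exp_neg_R_gRun_le_eps_pow`.)
Re-derived, kernel-checked (as `B10.smallFactor_le_pow` for (11)).  NOTE (v1.2): this reading was ALREADY certified, in
the stronger form `exp(−R₁r(g)) ≤ e^{−R₁}·g^N` for every real `0 ≤ N ≤ R₁`, by the b2b module
`B10Assembly.largeLoc_le_rpow` (§4c; cell GAPS C-r2.31) — kept here as the natural-number special case next to the
NEW reading `exp_neg_R_le_pow_of_one_lt` (r₀ > 1, R₁ fixed), which is what this section adds. [cite: Balaban1985UV3, (24) p.262] -/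
theorem exp_neg_R_le_pow {R₁ r₀ g : ℝ} (N : ℕ) (hr : 1 ≤ r₀) (hR : (N : ℝ) ≤ R₁) (hg : 0 < g) (hg1 : g ≤ 1) :
    Real.exp (-(R₁ * B10.rFun r₀ g)) ≤ g ^ N := by
  have hu : 0 ≤ Real.log g⁻¹ := B10.log_inv_nonneg_of_le_one hg hg1
  have hr' := log_inv_le_rFun hr hg hg1
  have hN : (0 : ℝ) ≤ N := Nat.cast_nonneg N
  rw [pow_eq_exp_neg_log hg]
  apply Real.exp_le_exp.2
  have : (N : ℝ) * Real.log g⁻¹ ≤ R₁ * B10.rFun r₀ g :=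
    mul_le_mul hR hr' hu (hN.trans hR)
  linarith

/-- p. 262 [8], *"smaller than arbitrary power of ε"* — the asymptotic reading with `R₁ > 0` FIXED: for `r₀ > 1` and
every `N`, `exp(−R₁r(g)) ≤ gᴺ` for all `0 < g ≤ exp(−u₀)`, `u₀ = (N/R₁)^{1/(r₀−1)}` (then `(1 + u)^{r₀} ≥
(1 + u₀)^{r₀−1}·u ≥ (N/R₁)·u` for `u = log g⁻¹ ≥ u₀`).  Print fixes `p₀ > 2` and leaves `r₀` free (p. 257; cell GAPS
G-B10-02): this is what `r₀ > 1` buys; for `r₀ = 1` only `exp(−R) = g^{R₁}`-type powers are available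
(`exp_neg_R_le_pow`).  Re-derived, kernel-checked. [cite: Balaban1985UV3, (24) p.262] -/
theorem exp_neg_R_le_pow_of_one_lt {R₁ r₀ : ℝ} (N : ℕ) (hr : 1 < r₀) (hR : 0 < R₁) {g : ℝ} (hg : 0 < g)
    (hgu : g ≤ Real.exp (-(((N : ℝ) / R₁) ^ (r₀ - 1)⁻¹))) :
    Real.exp (-(R₁ * B10.rFun r₀ g)) ≤ g ^ N := by
  set u₀ : ℝ := ((N : ℝ) / R₁) ^ (r₀ - 1)⁻¹ with hu₀_def
  set u : ℝ := Real.log g⁻¹ with hu_def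
  have hN : (0 : ℝ) ≤ N := Nat.cast_nonneg N
  have hNR : 0 ≤ (N : ℝ) / R₁ := div_nonneg hN hR.le
  have hu₀ : 0 ≤ u₀ := Real.rpow_nonneg hNR _
  have hr1 : r₀ - 1 ≠ 0 := by linarith
  -- `u ≥ u₀` from `g ≤ exp(−u₀)`
  have huu₀ : u₀ ≤ u := by
    have h1 : Real.log g ≤ -u₀ := by
      have := Real.log_le_log hg hgu
      rwa [Real.log_exp] at this
    rw [hu_def, Real.log_inv]
    linarith
  have hu : 0 ≤ u := hu₀.trans huu₀
  -- `(1 + u₀)^{r₀−1} ≥ u₀^{r₀−1} = N/R₁`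
  have hpow₀ : (N : ℝ) / R₁ ≤ (1 + u₀) ^ (r₀ - 1) := by
    have h1 : u₀ ^ (r₀ - 1) = (N : ℝ) / R₁ := by
      rw [hu₀_def]
      exact Real.rpow_inv_rpow hNR hr1
    rw [← h1]
    exact Real.rpow_le_rpow hu₀ (by linarith) (by linarith)
  -- `(1 + u)^{r₀} = (1 + u)^{r₀−1}·(1 + u) ≥ (1 + u₀)^{r₀−1}·u ≥ (N/R₁)·u`
  have hsplit : (1 + u) ^ r₀ = (1 + u) ^ (r₀ - 1) * (1 + u) := by
    have h1u : 0 < 1 + u := by linarith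
    conv_lhs => rw [show r₀ = (r₀ - 1) + 1 by ring]
    rw [Real.rpow_add h1u, Real.rpow_one]
  have hmono : (1 + u₀) ^ (r₀ - 1) ≤ (1 + u) ^ (r₀ - 1) :=
    Real.rpow_le_rpow (by linarith) (by linarith) (by linarith)
  have hkey : (N : ℝ) * u ≤ R₁ * B10.rFun r₀ g := by
    have hb : (N : ℝ) / R₁ ≤ (1 + u) ^ (r₀ - 1) := hpow₀.trans hmono
    have h2 : (N : ℝ) / R₁ * u ≤ (1 + u) ^ (r₀ - 1) * (1 + u) := by
      have h3 : (N : ℝ) / R₁ * u ≤ (1 + u) ^ (r₀ - 1) * u := mul_le_mul_of_nonneg_right hb hu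
      have h4 : (1 + u) ^ (r₀ - 1) * u ≤ (1 + u) ^ (r₀ - 1) * (1 + u) :=
        mul_le_mul_of_nonneg_left (by linarith) (Real.rpow_nonneg (by linarith) _)
      exact h3.trans h4
    have h5 : B10.rFun r₀ g = (1 + u) ^ (r₀ - 1) * (1 + u) := by
      rw [B10.rFun, ← hu_def, hsplit]
    rw [h5]
    have h6 : (N : ℝ) * u = R₁ * ((N : ℝ) / R₁ * u) := by field_simp
    rw [h6]
    exact mul_le_mul_of_nonneg_left h2 hR.le
  rw [pow_eq_exp_neg_log hg, ← hu_def]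
  exact Real.exp_le_exp.2 (by linarith)

/-- p. 262 [8] *"smaller than arbitrary power of ε"* AT `g₀ = gε^{1/2}` (p. 256: `g₀² = g²ε`; `B10.gRun g L ε 0`):
for `0 < g ≤ 1`, `0 < ε ≤ 1`, `r₀ ≥ 1` and `R₁ ≥ 2N`: `exp(−R₁r(g₀)) ≤ g₀^{2N} = g^{2N}εᴺ ≤ εᴺ`.  Re-derived,
kernel-checked. [cite: Balaban1985UV3, (24) p.262] -/
theorem exp_neg_R_gRun_le_eps_pow {R₁ r₀ g L ε : ℝ} (N : ℕ) (hr : 1 ≤ r₀) (hR : (2 * N : ℝ) ≤ R₁)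
    (hg : 0 < g) (hg1 : g ≤ 1) (hε : 0 < ε) (hε1 : ε ≤ 1) :
    Real.exp (-(R₁ * B10.rFun r₀ (B10.gRun g L ε 0))) ≤ ε ^ N := by
  have hg₀ : B10.gRun g L ε 0 = g * Real.sqrt ε := by simp [B10.gRun]
  have hsq : 0 < Real.sqrt ε := Real.sqrt_pos.2 hε
  have hsq1 : Real.sqrt ε ≤ 1 := Real.sqrt_le_one.mpr hε1
  have hg₀pos : 0 < B10.gRun g L ε 0 := by rw [hg₀]; positivity
  have hg₀1 : B10.gRun g L ε 0 ≤ 1 := by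
    rw [hg₀]
    calc g * Real.sqrt ε ≤ 1 * 1 := mul_le_mul hg1 hsq1 hsq.le zero_le_one
      _ = 1 := one_mul 1
  have h := exp_neg_R_le_pow (2 * N) hr (by push_cast; exact hR) hg₀pos hg₀1
  refine h.trans ?_
  rw [hg₀, mul_pow, pow_mul, pow_mul, Real.sq_sqrt hε.le]
  calc (g ^ 2) ^ N * ε ^ N ≤ 1 ^ N * ε ^ N := by
        apply mul_le_mul_of_nonneg_right _ (pow_nonneg hε.le N)
        exact pow_le_pow_left₀ (sq_nonneg g) (by nlinarith) N
    _ = ε ^ N := by rw [one_pow, one_mul]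

/-- p. 262 [8] *"smaller than arbitrary power of ε"* AT `g₀ = gε^{1/2}` in the asymptotic reading with `R₁ > 0`
FIXED (v1.2): for `r₀ > 1`, `0 < g ≤ 1` and every `N`, `exp(−R₁r(g₀)) ≤ εᴺ` as soon as
`0 < ε ≤ exp(−2u₀)`, `u₀ = (2N/R₁)^{1/(r₀−1)}` (then `g₀ = gε^{1/2} ≤ e^{−u₀}` and `exp_neg_R_le_pow_of_one_lt` gives
`≤ g₀^{2N} = g^{2N}εᴺ ≤ εᴺ`).  So with `r₀ > 1` the printed sentence needs NO largeness of `R₁` (cell SMALLNESS S-B10.9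
/ GAPS G-B10-02: print leaves `r₀` free and never states the size of `R₁`; `B10Assembly.largeLoc_le_rpow` covers
`r₀ ≥ 1` with the power limited by `R₁`).  Re-derived, kernel-checked. [cite: Balaban1985UV3, (24) p.262] -/
theorem exp_neg_R_gRun_le_eps_pow_of_one_lt {R₁ r₀ g L ε : ℝ} (N : ℕ) (hr : 1 < r₀) (hR : 0 < R₁)
    (hg : 0 < g) (hg1 : g ≤ 1) (hε : 0 < ε)
    (hεu : ε ≤ Real.exp (-(2 * (((2 * N : ℕ) : ℝ) / R₁) ^ (r₀ - 1)⁻¹))) :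
    Real.exp (-(R₁ * B10.rFun r₀ (B10.gRun g L ε 0))) ≤ ε ^ N := by
  set u₀ : ℝ := (((2 * N : ℕ) : ℝ) / R₁) ^ (r₀ - 1)⁻¹ with hu₀
  have hg₀ : B10.gRun g L ε 0 = g * Real.sqrt ε := by simp [B10.gRun]
  have hsq : 0 < Real.sqrt ε := Real.sqrt_pos.2 hε
  have hg₀pos : 0 < B10.gRun g L ε 0 := by rw [hg₀]; positivity
  -- `√ε ≤ e^{−u₀}` from `ε ≤ e^{−2u₀} = (e^{−u₀})²`
  have hsqrt : Real.sqrt ε ≤ Real.exp (-u₀) := by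
    have h2 : Real.exp (-(2 * u₀)) = Real.exp (-u₀) ^ 2 := by
      rw [show (-(2 * u₀)) = ((2 : ℕ) : ℝ) * (-u₀) by push_cast; ring, Real.exp_nat_mul]
    have h3 : Real.sqrt ε ≤ Real.sqrt (Real.exp (-(2 * u₀))) := Real.sqrt_le_sqrt hεu
    rwa [h2, Real.sqrt_sq (Real.exp_pos _).le] at h3
  have hg₀u : B10.gRun g L ε 0 ≤ Real.exp (-u₀) := by
    rw [hg₀]
    calc g * Real.sqrt ε ≤ 1 * Real.sqrt ε := mul_le_mul_of_nonneg_right hg1 hsq.le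
      _ = Real.sqrt ε := one_mul _
      _ ≤ Real.exp (-u₀) := hsqrt
  have h := exp_neg_R_le_pow_of_one_lt (2 * N) hr hR hg₀pos hg₀u
  refine h.trans ?_
  rw [hg₀, mul_pow, pow_mul, pow_mul, Real.sq_sqrt hε.le]
  calc (g ^ 2) ^ N * ε ^ N ≤ 1 ^ N * ε ^ N := by
        apply mul_le_mul_of_nonneg_right _ (pow_nonneg hε.le N)
        exact pow_le_pow_left₀ (sq_nonneg g) (by nlinarith) N
    _ = ε ^ N := by rw [one_pow, one_mul]

end Remainder24

/-! ## §6. (v1.1) The other silent input of (65): `|log Z^{(k)}(T₁^{(k)}, 1)| ≤ z|T₁^{(k)}|` from the one-sided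
Gaussian volume law -/

section LogZT

open Matrix MeasureTheory
open Literature.MathematicalPhysics.QuantumFieldTheory.Balaban1983to89.Beta
open Literature.MathematicalPhysics.QuantumFieldTheory.Balaban1983to89.B10Eq35Norm
  (le_form_of_sub_smul_one_posSemidef form_le_of_smul_one_sub_posSemidef isHermitian_of_sub_smul_one_posSemidef
    posDef_of_le_form abs_log_det_le_of_form_bounds log_two_pi_nonneg)

variable {n : Type*} [Fintype n] [DecidableEq n]

/-- **One-sided volume law for a Gaussian normalisation.**  For a symmetric precision form `Q` on `ℝⁿ` with
`c·1 ⪯ Q ⪯ a·1`, `0 < c`: `|log ∫ e^{−½⟨v,Qv⟩}dv| ≤ |n|·½(log 2π + max(|log c|, |log a|))` — by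
`Beta.GaussianIntegral.log_integral_exp_neg_half_quadForm` the logarithm is `(|n|/2) log 2π − ½ log det Q`, and
`|log det Q| ≤ |n|·max(|log c|, |log a|)` (`B10Eq35Norm.abs_log_det_le_of_form_bounds`).  Each integration variable
costs a constant depending on the spectral bounds only (the mechanism of cell GAPS C-adv9-28 (b), one-sided; the
two-sided difference form is `B10Eq35Norm.abs_log_gaussian_fromBlocks_sub_le`).  Located at (22) p. 261 [7]: *"dμ is
a Gaussian measure with a covariance having an exponential decay property (and many other properties, see Sect. E in
[5])"*. [cite: Balaban1985UV3, (22) p.261] -/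
theorem abs_log_gaussian_le_of_form_bounds {Q : Matrix n n ℝ} {c a : ℝ} (hc : 0 < c)
    (hlo : (Q - c • (1 : Matrix n n ℝ)).PosSemidef) (hhi : (a • (1 : Matrix n n ℝ) - Q).PosSemidef) :
    |Real.log (∫ v : n → ℝ, Real.exp (-(1/2 : ℝ) * (v ⬝ᵥ Q *ᵥ v)))|
      ≤ Fintype.card n * ((Real.log (2 * Real.pi) + max |Real.log c| |Real.log a|) / 2) := by
  have hQh : Q.IsHermitian := isHermitian_of_sub_smul_one_posSemidef hlo
  have hlo' := le_form_of_sub_smul_one_posSemidef hlo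
  have hhi' := form_le_of_smul_one_sub_posSemidef hhi
  have hQpd : Q.PosDef := posDef_of_le_form hQh hc hlo'
  have hdet := abs_log_det_le_of_form_bounds hQh hc hlo' hhi'
  rw [GaussianIntegral.log_integral_exp_neg_half_quadForm _ hQpd]
  set L : ℝ := Real.log (2 * Real.pi) with hL
  set μ : ℝ := max |Real.log c| |Real.log a| with hμ
  have hN : (0 : ℝ) ≤ Fintype.card n := Nat.cast_nonneg _
  have hL0 : 0 ≤ L := log_two_pi_nonneg
  calc |(Fintype.card n : ℝ) / 2 * L - 1 / 2 * Real.log Q.det|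
      ≤ |(Fintype.card n : ℝ) / 2 * L| + |1 / 2 * Real.log Q.det| := abs_sub _ _
    _ = (Fintype.card n : ℝ) / 2 * L + 1 / 2 * |Real.log Q.det| := by
        rw [abs_mul, abs_mul, abs_of_nonneg (by positivity : (0 : ℝ) ≤ Fintype.card n / 2), abs_of_nonneg hL0,
          abs_of_nonneg (by norm_num : (0 : ℝ) ≤ 1 / 2)]
    _ ≤ (Fintype.card n : ℝ) / 2 * L + 1 / 2 * (Fintype.card n * μ) := by gcongr
    _ = Fintype.card n * ((L + μ) / 2) := by ring

/-- **`|log Z^{(k)}(T₁^{(k)}, 1)| ≤ z|T₁^{(k)}|`, given the Gaussian model** (the hypothesis `hZ` of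
`B10.Estep62_abs_le` = field `B10Assembly.LeafSystem.logZT_le`, p. 273 [19] *"we get easily |E^{(j)}| ≤ O(1)|T₁^{(j)}|"*,
the `log Z^{(k)}(T₁^{(k)}, 1)` term of (62) p. 271 [17]): if the printed number `log Z` IS a constraint-elimination
constant `J` plus the logarithm of the Gaussian integral of a symmetric precision form `Q` with `c·1 ⪯ Q ⪯ a·1`,
`0 < c` (the identification of `B10Eq35Norm.Norm35Model`, whole-lattice side; positivity = [5] Thm. 3.11, upper
bound = boundedness of the difference operator), the number of integration variables is at most `c_T·|T₁^{(k)}|`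
(they sit on the bonds of `T₁^{(k)}`: 3 per site in d = 3, minus constraints) and `|J| ≤ c_J·|T₁^{(k)}|` (the
δ-function eliminations are per-coarse-bond local), then `|log Z| ≤ (c_T·½(log 2π + max(|log c|, |log a|)) +
c_J)·|T₁^{(k)}|`.  The model data are hypotheses (print does not define Z^{(0)}, cell GAPS G-B10-03); re-derived
bookkeeping. [cite: Balaban1985UV3, (62) p.271 + (65) p.273] -/
theorem logZT_le_of_gaussian {Q : Matrix n n ℝ} {c a : ℝ} (hc : 0 < c)
    (hlo : (Q - c • (1 : Matrix n n ℝ)).PosSemidef) (hhi : (a • (1 : Matrix n n ℝ) - Q).PosSemidef)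
    {logZ J sites cT cJ : ℝ}
    (hZ : logZ = J + Real.log (∫ v : n → ℝ, Real.exp (-(1/2 : ℝ) * (v ⬝ᵥ Q *ᵥ v))))
    (hn : (Fintype.card n : ℝ) ≤ cT * sites) (hJ : |J| ≤ cJ * sites) :
    |logZ| ≤ (cT * ((Real.log (2 * Real.pi) + max |Real.log c| |Real.log a|) / 2) + cJ) * sites := by
  set u : ℝ := (Real.log (2 * Real.pi) + max |Real.log c| |Real.log a|) / 2 with hu
  have hu0 : 0 ≤ u := by
    have h1 : 0 ≤ max |Real.log c| |Real.log a| := (abs_nonneg _).trans (le_max_left _ _)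
    have h2 := log_two_pi_nonneg
    rw [hu]; positivity
  have hG := abs_log_gaussian_le_of_form_bounds hc hlo hhi
  rw [← hu] at hG
  have hG' : |Real.log (∫ v : n → ℝ, Real.exp (-(1/2 : ℝ) * (v ⬝ᵥ Q *ᵥ v)))| ≤ cT * sites * u :=
    hG.trans (mul_le_mul_of_nonneg_right hn hu0)
  rw [hZ]
  calc |J + Real.log (∫ v : n → ℝ, Real.exp (-(1/2 : ℝ) * (v ⬝ᵥ Q *ᵥ v)))|
      ≤ |J| + |Real.log (∫ v : n → ℝ, Real.exp (-(1/2 : ℝ) * (v ⬝ᵥ Q *ᵥ v)))| := abs_add_le _ _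
    _ ≤ cJ * sites + cT * sites * u := add_le_add hJ hG'
    _ = (cT * u + cJ) * sites := by ring

variable {S : LocDomainSys} (G : CubeSystem S) {Δ : ℕ} {c₀ κ g C : ℝ} {Cfg : Type}

/-- **(62) ⇒ the per-step bound of (65), BOTH silent inputs discharged**: `B10.Estep62_abs_le` with `hP` supplied
from (25) (`abs_sum_act_le_sites`, §3: `aP = C·g·K₀(c₀,Δ)`) and `hZ` from the Gaussian model (`logZT_le_of_gaussian`:
`z = c_T·½(log 2π + max(|log c|, |log a|)) + c_J`): `|log σ₀·|T*| + d(𝔤) log g·|T*| + log Z^{(k)}(T, 1) + Σ_X 𝒫′(X, U)|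
≤ (3|log σ₀| + z + aP + 3 d(𝔤)|log g|)·|T₁^{(k)}|` — p. 273 *"we get easily |E^{(j)}| ≤ O(1)|T₁^{(j)}|"* with every
O(1) explicit (affine in |log g_j| because of the d(𝔤) log g_k term of (62), cell GAPS G-B10-01).  Remaining inputs:
`|T*| ≤ 3|T|`, the (25) leaf, the Gaussian identification, the volume leaf. [cite: Balaban1985UV3, (62) p.271 + (65) p.273] -/
theorem estep62_abs_le_discharged (hΔ : G.DegreeLE Δ) (hV : G.VolumeLeaf c₀) (hκ : kappa₀ c₀ Δ ≤ κ)
    (act : S.Dom → Cfg → ℝ) (hCg : 0 ≤ C * g) (h25 : B10.Bound25Printed ⟨S.Dom, Cfg, S.dj, act⟩ g κ C) (U : Cfg)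
    {Q : Matrix n n ℝ} {c a : ℝ} (hc : 0 < c)
    (hlo : (Q - c • (1 : Matrix n n ℝ)).PosSemidef) (hhi : (a • (1 : Matrix n n ℝ) - Q).PosSemidef)
    {logZ J sites cT cJ : ℝ}
    (hZ : logZ = J + Real.log (∫ v : n → ℝ, Real.exp (-(1/2 : ℝ) * (v ⬝ᵥ Q *ᵥ v))))
    (hn : (Fintype.card n : ℝ) ≤ cT * sites) (hJ : |J| ≤ cJ * sites)
    (logσ₀ dg logg bonds : ℝ) (hdg : 0 ≤ dg) (hb0 : 0 ≤ bonds) (hb : bonds ≤ 3 * sites)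
    (hcs : (Fintype.card G.Cube : ℝ) ≤ sites) :
    |logσ₀ * bonds + dg * logg * bonds + logZ + ∑ X : S.Dom, act X U|
      ≤ (3 * |logσ₀| + (cT * ((Real.log (2 * Real.pi) + max |Real.log c| |Real.log a|) / 2) + cJ)
          + C * g * K₀ c₀ Δ + 3 * dg * |logg|) * sites :=
  B10.Estep62_abs_le logσ₀ dg logg logZ (∑ X : S.Dom, act X U) bonds sites (C * g * K₀ c₀ Δ) _ hdg hb0 hb
    (logZT_le_of_gaussian hc hlo hhi hZ hn hJ) (abs_sum_act_le_sites G hΔ hV hκ act hCg h25 U hcs)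

end LogZT

/-! ## §7. (v1.3) The same edge WITHOUT the quoted volume leaf: the elementary tree-length bound
`𝓛(X) ≥ ℓ₀(#blocks(X) − 1)` suffices -/

section TreeLength

variable {S : LocDomainSys} (G : CubeSystem S) {Δ : ℕ} {κ g C ℓ₀ : ℝ} {Cfg : Type}

/-- `1 ≤ ℓ₀⁻¹` for `0 < ℓ₀ ≤ 1`. [folklore] -/
private theorem one_le_inv_of_le_one (hℓ₀ : 0 < ℓ₀) (hℓ₁ : ℓ₀ ≤ 1) : 1 ≤ ℓ₀⁻¹ := by
  rw [le_inv_comm₀ one_pos hℓ₀, inv_one]; exact hℓ₁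

/-- **(25) ⇒ Σ_X |𝒫′(X, U)| ≤ C·g·K₀(ℓ₀⁻¹,Δ)·#blocks WITHOUT the volume leaf.**  p. 262 [8], verbatim: *"we define a
linear size 𝓛(X) of a localization X as the length of a shortest tree graph connecting the centers of big blocks in
X, and other points, if the big blocks are scaled to unit cubes, i.e. the distance between centers of neighbouring
blocks is taken to be equal to 1."* — hence the elementary bound `𝓛(X) ≥ ℓ₀·(#blocks(X) − 1)` (distinct centres are
at distance ≥ 1: `ℓ₀ = 1` for a tree whose vertices are the centres; `ℓ₀ = ½` when *"other points"* (Steiner points)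
are allowed — double the tree into a closed walk through all centres), taken here as the hypothesis `hL` with any
`0 < ℓ₀ ≤ 1` (the block geometry is not modelled, cell DIVERGENCE F5).  Under it the auxiliary size
`𝓛′(X) := ℓ₀(#blocks(X) − 1) ≤ 𝓛(X)` obeys the volume leaf with `c₀ = ℓ₀⁻¹` EXACTLY, (25) at rate κ for 𝓛 implies (25)
at rate κ for 𝓛′, and §2–§3 apply to the auxiliary `CubeSystem`: for wall-degree ≤ Δ and `κ ≥ κ₀(ℓ₀⁻¹,Δ) =
ℓ₀⁻¹ log(2(Δ+1)²)`, `Σ_X |𝒫′(X, U)| ≤ C·g·K₀(ℓ₀⁻¹,Δ)·#blocks`.  (So the B10 edge (25) → (65) needs only the lattice-animal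
count and this tree-length inequality, not [Dimock2013BalabanII] Lemma E.1.) [cite: Balaban1985UV3, (25) p.262 + (65) p.273] -/
theorem sum_abs_act_le_of_bound25_treeLength (hΔ : G.DegreeLE Δ) (hℓ₀ : 0 < ℓ₀) (hℓ₁ : ℓ₀ ≤ 1)
    (hL : ∀ X : S.Dom, ℓ₀ * ((G.vol X : ℝ) - 1) ≤ S.dj X) (hκ : kappa₀ ℓ₀⁻¹ Δ ≤ κ)
    (act : S.Dom → Cfg → ℝ) (hCg : 0 ≤ C * g) (h25 : B10.Bound25Printed ⟨S.Dom, Cfg, S.dj, act⟩ g κ C) (U : Cfg) :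
    ∑ X : S.Dom, |act X U| ≤ C * g * K₀ ℓ₀⁻¹ Δ * Fintype.card G.Cube := by
  have hκ0 : 0 ≤ κ := (B12TreeDecay.kappa₀_nonneg (inv_pos.2 hℓ₀).le Δ).trans hκ
  -- the auxiliary system: same domains and blocks, size 𝓛′(X) = ℓ₀(#blocks(X) − 1)
  let S' : LocDomainSys :=
    { Dom := S.Dom
      dj := fun X => ℓ₀ * ((G.vol X : ℝ) - 1)
      dj_nonneg := fun X => by
        have h1 : (1 : ℝ) ≤ G.vol X := by exact_mod_cast G.vol_pos X
        exact mul_nonneg hℓ₀.le (by linarith) }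
  let G' : CubeSystem S' :=
    { Cube := G.Cube
      Adj := G.Adj
      adj_symm := G.adj_symm
      nbr := G.nbr
      mem_nbr := G.mem_nbr
      cubes := G.cubes
      cubes_injective := G.cubes_injective
      connected := G.connected }
  have hΔ' : G'.DegreeLE Δ := hΔ
  have hV' : G'.VolumeLeaf ℓ₀⁻¹ := by
    intro X
    change ((G.cubes X).card : ℝ) ≤ ℓ₀⁻¹ * (1 + ℓ₀ * (((G.cubes X).card : ℝ) - 1))
    have hinv := one_le_inv_of_le_one hℓ₀ hℓ₁
    have hid : ℓ₀⁻¹ * (1 + ℓ₀ * (((G.cubes X).card : ℝ) - 1)) = ℓ₀⁻¹ + (((G.cubes X).card : ℝ) - 1) := by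
      field_simp
    rw [hid]
    linarith
  have key : ∑ X : S.Dom, Real.exp (-κ * (ℓ₀ * ((G.vol X : ℝ) - 1))) ≤ K₀ ℓ₀⁻¹ Δ * Fintype.card G.Cube :=
    sum_exp_tree_le_card G' hΔ' hV' hκ
  calc ∑ X : S.Dom, |act X U| ≤ ∑ X : S.Dom, C * g * Real.exp (-κ * S.dj X) :=
        Finset.sum_le_sum fun X _ => by rw [neg_mul]; exact h25 X U
    _ ≤ ∑ X : S.Dom, C * g * Real.exp (-κ * (ℓ₀ * ((G.vol X : ℝ) - 1))) :=
        Finset.sum_le_sum fun X _ => mul_le_mul_of_nonneg_left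
          (Real.exp_le_exp.2 (by nlinarith [hL X])) hCg
    _ = C * g * ∑ X : S.Dom, Real.exp (-κ * (ℓ₀ * ((G.vol X : ℝ) - 1))) := by rw [Finset.mul_sum]
    _ ≤ C * g * (K₀ ℓ₀⁻¹ Δ * Fintype.card G.Cube) := mul_le_mul_of_nonneg_left key hCg
    _ = C * g * K₀ ℓ₀⁻¹ Δ * Fintype.card G.Cube := by ring

/-- The first clause of (65) p. 273, leaf-free form: `|Σ_X 𝒫′(X, U)| ≤ (C·g·K₀(ℓ₀⁻¹,Δ))·|T₁^{(j)}|` given (25), wall-degree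
≤ Δ, the tree-length bound `𝓛(X) ≥ ℓ₀(#blocks(X) − 1)` and `#blocks ≤ |T₁^{(j)}|`. [cite: Balaban1985UV3, (65) p.273] -/
theorem abs_sum_act_le_sites_treeLength (hΔ : G.DegreeLE Δ) (hℓ₀ : 0 < ℓ₀) (hℓ₁ : ℓ₀ ≤ 1)
    (hL : ∀ X : S.Dom, ℓ₀ * ((G.vol X : ℝ) - 1) ≤ S.dj X) (hκ : kappa₀ ℓ₀⁻¹ Δ ≤ κ)
    (act : S.Dom → Cfg → ℝ) (hCg : 0 ≤ C * g) (h25 : B10.Bound25Printed ⟨S.Dom, Cfg, S.dj, act⟩ g κ C) (U : Cfg)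
    {sites : ℝ} (hcs : (Fintype.card G.Cube : ℝ) ≤ sites) :
    |∑ X : S.Dom, act X U| ≤ (C * g * K₀ ℓ₀⁻¹ Δ) * sites :=
  ((Finset.abs_sum_le_sum_abs _ _).trans
    (sum_abs_act_le_of_bound25_treeLength G hΔ hℓ₀ hℓ₁ hL hκ act hCg h25 U)).trans
    (mul_le_mul_of_nonneg_left hcs (mul_nonneg hCg (K₀_pos _ Δ).le))

end TreeLength

end Literature.MathematicalPhysics.QuantumFieldTheory.Balaban1983to89.B10Eq65PolymerSum

end
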